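import Summits.QuantumFields.YangMills.Theorems.PoincareLipschitzHierAlignT3Level
import Literature.MathematicalPhysics.QuantumFieldTheory.Balaban1983to89.T3SmallLiftHistory
import HarnessLib

/-!
# Crux stmt-QuantumFields-19936 `HistoryTailL` — S-ALIGN (S2) letters: the recursion arithmetic and the smallness of the sharp tower

Cell `ym3-torus` (rung R3 = YM₃ on T³ — a RUNG, NOT the Clay problem), width seat `ym-ust-19936-w3` gen 12, `--supports stmt-QuantumFields-19936 --as helper`.
Summons w2 g11 02:42:44Z «w3 g12: S-ALIGN».  Split off ✓`PoincareLipschitzHierAlignT3Sharp` (400-line rule): `arith_level` (the absorbed recursion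
`X∕L + 3840(X+w)² + 15w + 44L²θ ≤ 72L²θ + (2∕L)X`), `θBal_pred_le` (one level costs `L`), `geom_two_div_le`, `tdist_le_three_of_inCube`,
`int_eq_of_cast_eq`, `shift_shift_comm'`, `dist1_plaqHol_gaugeAct_lt`, ★`sharp_smallness` (under `θBal ≤ 1∕(2·10⁷L⁴)`: `32(X+w) ≤ 1∕10`,
`3840L(X+w) ≤ 1` for `X = β_{i+1}`, `w = 4θ_{i+1}`).  Def-free.
-/


noncomputable section

open scoped BigOperators

namespace Summit.QuantumFields.YangMills.Theorems.PoincareLipschitzHierAlignT3SharpLetters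

open Literature.MathematicalPhysics.QuantumFieldTheory.Balaban1983to89
open Literature.MathematicalPhysics.QuantumFieldTheory.Balaban1983to89.T3ContinuumYM3Torus
open Literature.MathematicalPhysics.QuantumFieldTheory.Balaban1983to89.T3UnitLawDensityEML
open T4Continuum BlockAveraging ExpMeanLog T3UnitScaleTilt
open Literature.MathematicalPhysics.QuantumFieldTheory.Balaban1983to89.B3Taylor310LocalRemainder (tdist_triangle tdist_comm tdist_self)
open Summit.QuantumFields.YangMills.Theorems.PoincareLipschitzHierAlignT3Geometry
open Summit.QuantumFields.YangMills.Theorems.PoincareLipschitzHierAlignT3 (twentytwo_lt_sitesPerDir_succ guard_lt_deltaSU)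
open Summit.QuantumFields.YangMills.Theorems.PoincareLipschitzHierAlignT3Level (exists_hierGauge_dist1_le_of_windows_level)
open T4AxialGaugeSmallField (castSite castSite_apply boxPlaqs axialGauge dist1_gaugeAct_axialGauge_le_uniform)
open B7Prop1Explicit (e e_apply)

variable {F : T3Family} {K j : ℕ} {γ b₀ p₀ : ℝ}

/-! ## §1 Arithmetic and small letters -/

/-- ★ **THE RECURSION ARITHMETIC**: `X∕L + 3840(X+w)² + 15w + 7·(25L²∕4)θ ≤ 72L²θ + (2∕L)X` once `3840L(X+w) ≤ 1`, `w ≤ 4Lθ`, `L ≥ 3`. [folklore] -/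
theorem arith_level {X w θ L : ℝ} (hX0 : 0 ≤ X) (hw0 : 0 ≤ w) (hθ : 0 ≤ θ) (hL : 3 ≤ L) (hq : 3840 * L * (X + w) ≤ 1)
    (hw : w ≤ 4 * L * θ) :
    X / L + 240 * (((3 : ℝ) + 1) * (X + w)) ^ 2 + (4 * (3 : ℝ) + 3) * w + 7 * ((5 * L) ^ 2 / 4 * θ) ≤
      72 * L ^ 2 * θ + (2 / L) * X := by
  have hL0 : 0 < L := by linarith
  have hXw : 0 ≤ X + w := by linarith
  have hquad : 240 * (((3 : ℝ) + 1) * (X + w)) ^ 2 ≤ (X + w) / L := by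
    rw [le_div_iff₀ hL0]
    have : 240 * (((3 : ℝ) + 1) * (X + w)) ^ 2 * L = (X + w) * (3840 * L * (X + w)) := by ring
    rw [this]
    exact mul_le_of_le_one_right hXw hq
  have e1 : (X + w) / L = X / L + w / L := add_div _ _ _
  have hwL : w / L ≤ w := div_le_self hw0 (by linarith)
  have e2 : X / L + X / L = (2 / L) * X := by ring
  have h64 : 64 * L * θ ≤ 22 * L ^ 2 * θ := by nlinarith
  nlinarith

/-- `θBal(K−(i+1)) ≤ L·θBal(K−i)` (one level down costs at most `L`). [cite: Balaban1985UV3, (3) p.256] -/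
theorem θBal_pred_le (hL : 1 ≤ F.L) (hγ : 0 < γ) (hγ1 : γ ≤ 1) (hb : 0 ≤ b₀) (hp : 0 ≤ p₀) {i : ℕ} (hiK : i + 1 ≤ K) :
    θBal F.L γ b₀ p₀ (K - (i + 1)) ≤ (F.L : ℝ) * θBal F.L γ b₀ p₀ (K - i) := by
  have hL1 : (1 : ℝ) ≤ (F.L : ℝ) := by exact_mod_cast hL
  have hLpos : (0 : ℝ) < (F.L : ℝ) := by linarith
  have hsqrt : Real.sqrt (F.L : ℝ) ≤ (F.L : ℝ) := by
    calc Real.sqrt (F.L : ℝ) ≤ Real.sqrt ((F.L : ℝ) ^ 2) := Real.sqrt_le_sqrt (by nlinarith)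
      _ = (F.L : ℝ) := Real.sqrt_sq hLpos.le
  have hκ : (F.L : ℝ)⁻¹ * Real.sqrt (F.L : ℝ) ≤ 1 := by
    rw [inv_mul_le_iff₀ hLpos, mul_one]; exact hsqrt
  have h := T3SmallLiftHistory.mul_θBal_le_θBal_succ hL hγ hγ1 hb hp hκ (K - (i + 1))
  have e : K - (i + 1) + 1 = K - i := by omega
  rw [e, inv_mul_le_iff₀ hLpos] at h
  exact h

/-- `Σ_{k<n} (2∕L)^k ≤ 3` for `L ≥ 3`. [folklore] -/
theorem geom_two_div_le (hL : 3 ≤ F.L) (n : ℕ) : ∑ k ∈ Finset.range n, ((2 : ℝ) / F.L) ^ k ≤ 3 := by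
  have hLr : (3 : ℝ) ≤ F.L := by exact_mod_cast hL
  have hr0 : (0 : ℝ) ≤ 2 / F.L := by positivity
  have hr1 : (2 : ℝ) / F.L ≤ 2 / 3 := by
    rw [div_le_div_iff₀ (by linarith) (by norm_num)]; linarith
  have h := geom_sum_Ico_le_of_lt_one (m := 0) (n := n) hr0 (by linarith)
  rw [Finset.range_eq_Ico]
  refine h.trans ?_
  rw [pow_zero, div_le_iff₀ (by linarith)]
  linarith

/-- Unit-cube neighbours are within torus distance `3`. [folklore] -/
theorem tdist_le_three_of_inCube {i : ℕ} (y s : Site (F.P K) i)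
    (h : ∀ k, ∃ e : ℤ, -1 ≤ e ∧ e ≤ 1 ∧ y k = s k + ((e : ℤ) : ZMod ((F.P K).sitesPerDir i))) : Site.tdist y s ≤ 3 := by
  refine tdist_le_three_of_near y s fun k => ?_
  obtain ⟨a, ha1, ha2, ha⟩ := h k
  rcases (show a = 0 ∨ a = 1 ∨ a = -1 by omega) with h0 | h1 | h2
  · left; rw [ha, h0]; simp
  · right; left; rw [ha, h1]; simp
  · right; right; rw [ha, h2]; simp [sub_eq_add_neg]

/-- Small integers with equal casts are equal (`sitesPerDir > 3`). [folklore] -/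
theorem int_eq_of_cast_eq {i : ℕ} (hN : 3 < (F.P K).sitesPerDir i) {a b : ℤ} (ha : -1 ≤ a ∧ a ≤ 2) (hb : -1 ≤ b ∧ b ≤ 2)
    (h : ((a : ℤ) : ZMod ((F.P K).sitesPerDir i)) = ((b : ℤ) : ZMod ((F.P K).sitesPerDir i))) : a = b := by
  rw [ZMod.intCast_eq_intCast_iff_dvd_sub] at h
  have hN' : (3 : ℤ) < ((F.P K).sitesPerDir i : ℤ) := by exact_mod_cast hN
  have habs : |b - a| < ((F.P K).sitesPerDir i : ℤ) := by rw [abs_lt]; constructor <;> omega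
  have := Int.eq_zero_of_abs_lt_dvd h habs
  omega

/-- Two steps commute. [folklore] -/
theorem shift_shift_comm' {i : ℕ} (x : Site (F.P K) i) (μ ν : Fin (F.P K).d) : (x.shift μ).shift ν = (x.shift ν).shift μ := by
  funext k
  by_cases h1 : k = ν
  · subst h1
    by_cases h2 : k = μ
    · subst h2; rfl
    · simp only [Site.shift, Function.update_self, Function.update_of_ne h2]
  · by_cases h2 : k = μ
    · subst h2
      simp only [Site.shift, Function.update_self, Function.update_of_ne h1]
    · simp only [Site.shift, Function.update_of_ne h1, Function.update_of_ne h2]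

/-- Plaquettes of a gauged field have the size of the plaquettes. [folklore] -/
theorem dist1_plaqHol_gaugeAct_lt {i : ℕ} {G : Type*} [GaugeGroup G] (u : GaugeTransf (F.P K) i G) (V : GaugeField (F.P K) i G)
    (p : Plaq (F.P K) i) {δ : ℝ} (h : dist1 (GaugeField.plaqHol V p) < δ) : dist1 (GaugeField.plaqHol (GaugeField.gaugeAct u V) p) < δ := by
  have e : GaugeField.plaqHol (GaugeField.gaugeAct u V) p = u p.src * GaugeField.plaqHol V p * (u p.src)⁻¹ := by
    simp only [GaugeField.plaqHol, GaugeField.gaugeAct, PBond.tgt]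
    rw [shift_shift_comm' p.src p.μ p.ν]
    group
  rw [e, GaugeGroup.dist1_conj]; exact h

/-! ## §2 The data of one sharp step at the crux's windows -/

/-- **Smallness**: under `θBal ≤ 1∕(2·10⁷L⁴)` the level-`(i+1)` bound `X = β_{i+1}` and `w = 4θ_{i+1}` satisfy the two guards of the sharp step and
of the absorption (`32(X+w) ≤ 1∕10`, `3840L(X+w) ≤ 1`). [folklore] -/
theorem sharp_smallness (hγ : 0 < γ) (hγ1 : γ ≤ 1) (hb : 0 < b₀)
    (hθσ : ∀ i, i ≤ j → θBal F.L γ b₀ p₀ (K - i) ≤ 1 / (2 * 10 ^ 7 * (F.L : ℝ) ^ 4)) {i : ℕ} (hij : i < j) :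
    let X : ℝ := 72 * (F.L : ℝ) ^ 2 * (∑ i' ∈ Finset.Ico (i + 1) j, θBal F.L γ b₀ p₀ (K - i') * ((2 : ℝ) / F.L) ^ (i' - (i + 1))) +
      6694 * (F.L : ℝ) ^ 2 * θBal F.L γ b₀ p₀ (K - j) * ((2 : ℝ) / F.L) ^ (j - (i + 1))
    let w : ℝ := 4 * θBal F.L γ b₀ p₀ (K - (i + 1))
    0 ≤ X ∧ 0 ≤ w ∧ 8 * ((3 : ℝ) + 1) * (X + w) ≤ 1 / 10 ∧ 3840 * (F.L : ℝ) * (X + w) ≤ 1 := by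
  intro X w
  have hL3 : 3 ≤ F.L := (by obtain ⟨k, hk⟩ := F.hL.1; have := F.hL.2; omega)
  have hLr : (3 : ℝ) ≤ F.L := by exact_mod_cast hL3
  have hθ0 : ∀ i, 0 ≤ θBal F.L γ b₀ p₀ (K - i) := fun i =>
    (T3MinimiserStabilityReduction.θBal_pos (by omega) hγ hγ1 hb p₀ (K - i)).le
  have hr0 : (0 : ℝ) ≤ 2 / F.L := by positivity
  have hX0 : 0 ≤ X := by
    have : 0 ≤ ∑ i' ∈ Finset.Ico (i + 1) j, θBal F.L γ b₀ p₀ (K - i') * ((2 : ℝ) / F.L) ^ (i' - (i + 1)) :=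
      Finset.sum_nonneg fun i' _ => mul_nonneg (hθ0 i') (pow_nonneg hr0 _)
    have := hθ0 j
    show 0 ≤ 72 * (F.L : ℝ) ^ 2 * _ + _
    positivity
  have hw0 : 0 ≤ w := by show 0 ≤ 4 * _; linarith [hθ0 (i + 1)]
  set σ : ℝ := 1 / (2 * 10 ^ 7 * (F.L : ℝ) ^ 4) with hσ
  have hσ0 : 0 < σ := by rw [hσ]; positivity
  have hsum : ∑ i' ∈ Finset.Ico (i + 1) j, θBal F.L γ b₀ p₀ (K - i') * ((2 : ℝ) / F.L) ^ (i' - (i + 1)) ≤ 3 * σ := by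
    calc ∑ i' ∈ Finset.Ico (i + 1) j, θBal F.L γ b₀ p₀ (K - i') * ((2 : ℝ) / F.L) ^ (i' - (i + 1))
        ≤ ∑ i' ∈ Finset.Ico (i + 1) j, σ * ((2 : ℝ) / F.L) ^ (i' - (i + 1)) :=
          Finset.sum_le_sum fun i' hi' => mul_le_mul_of_nonneg_right (hθσ i' (by
            have := (Finset.mem_Ico.1 hi').2; omega)) (pow_nonneg hr0 _)
      _ = σ * ∑ k ∈ Finset.range (j - (i + 1)), ((2 : ℝ) / F.L) ^ k := by
          rw [Finset.mul_sum, Finset.sum_Ico_eq_sum_range]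
          refine Finset.sum_congr rfl fun k _ => ?_
          congr 2; omega
      _ ≤ σ * 3 := mul_le_mul_of_nonneg_left (geom_two_div_le hL3 _) hσ0.le
      _ = 3 * σ := by ring
  have h2 : θBal F.L γ b₀ p₀ (K - j) * ((2 : ℝ) / F.L) ^ (j - (i + 1)) ≤ σ := by
    calc θBal F.L γ b₀ p₀ (K - j) * ((2 : ℝ) / F.L) ^ (j - (i + 1)) ≤ σ * 1 :=
          mul_le_mul (hθσ j le_rfl) (pow_le_one₀ hr0 (by rw [div_le_one (by linarith)]; linarith)) (pow_nonneg hr0 _) hσ0.le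
      _ = σ := mul_one _
  have hL2 : (1 : ℝ) ≤ (F.L : ℝ) ^ 2 := by nlinarith
  have hXle : X ≤ 6910 * (F.L : ℝ) ^ 2 * σ := by
    show 72 * (F.L : ℝ) ^ 2 * _ + _ ≤ _
    nlinarith [sq_nonneg (F.L : ℝ)]
  have hwle : w ≤ 4 * σ := by show 4 * _ ≤ _; linarith [hθσ (i + 1) (by omega)]
  have hXw : X + w ≤ 6914 * (F.L : ℝ) ^ 2 * σ := by nlinarith
  have hσL : (F.L : ℝ) ^ 4 * σ = 1 / (2 * 10 ^ 7) := by rw [hσ]; field_simp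
  have hL4 : (F.L : ℝ) ^ 2 ≤ (F.L : ℝ) ^ 4 := by nlinarith
  have hL34 : (F.L : ℝ) ^ 3 ≤ (F.L : ℝ) ^ 4 := by nlinarith
  refine ⟨hX0, hw0, ?_, ?_⟩
  · have : (F.L : ℝ) ^ 2 * σ ≤ 1 / (2 * 10 ^ 7) := by
      calc (F.L : ℝ) ^ 2 * σ ≤ (F.L : ℝ) ^ 4 * σ := mul_le_mul_of_nonneg_right hL4 hσ0.le
        _ = _ := hσL
    nlinarith
  · have : (F.L : ℝ) ^ 3 * σ ≤ 1 / (2 * 10 ^ 7) := by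
      calc (F.L : ℝ) ^ 3 * σ ≤ (F.L : ℝ) ^ 4 * σ := mul_le_mul_of_nonneg_right hL34 hσ0.le
        _ = _ := hσL
    have e3 : 3840 * (F.L : ℝ) * (6914 * (F.L : ℝ) ^ 2 * σ) = 3840 * 6914 * ((F.L : ℝ) ^ 3 * σ) := by ring
    nlinarith

end Summit.QuantumFields.YangMills.Theorems.PoincareLipschitzHierAlignT3SharpLetters

end
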